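import Summits.QuantumFields.QCD.Theorems.SpectralDefectExtinctionWegnerEstimateCoareaCore
import Summits.QuantumFields.QCD.Theorems.SpectralDefectExtinctionWegnerEstimateCoareaTransport
import Summits.QuantumFields.QCD.Theorems.SpectralDefectExtinctionWegnerEstimateCoareaSu3Circles
import Summits.QuantumFields.QCD.Theorems.SpectralDefectExtinctionWegnerEstimateStubCellAverageBound
import Summits.QuantumFields.QCD.Theorems.SpectralDefectExtinctionWegnerEstimateStubLocalTraceRegular

/-!
# Stub `coareaWegner` of line `Sketch` (skeleton "ResolventCell") for crux `SpectralDefectExtinction.WegnerEstimate`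
(item stmt-QuantumFields-8966) — RANGED variant (gen 4b, lead c4): tori `L ≥ L₀` only

Verbatim the landed 1-D coarea route `stub_coareaWegner` (p145270, this namespace) with the torus side restricted to
`L ≥ L₀` in BOTH the rigidity/small-ball hypothesis and the conclusion: the proof is pointwise in `(L, x, m₀, ε, U)`, so
nothing changes but the range.  Purpose: the gen-4b skeleton treats the THERMODYNAMIC regime `L ≥ 2R + 3` (generic window
data, ε-net architecture for the small ball) and the SMALL tori `2 ≤ L < 2R + 3` (finite-dimensional Wegner estimates,
toron corner) by different routes; this file is the coarea route of the former.  Written by the line lead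
(prover-line-stmt-QuantumFields-8966-c4-0); mathematics by the gen-2 lead and workers (see the landed file).
-/

noncomputable section

namespace Summit.QuantumFields.QCD.Cruxes.WegnerEstimate.ResolventCell

open MeasureTheory Filter
open scoped Matrix BigOperators ENNReal NNReal Topology
open Literature.MathematicalPhysics.QuantumLattice Literature.MathematicalPhysics.QuantumFieldTheory
  Literature.Probability.LatticeModels
open Literature.Barriers.QuantumFields (isHermitian_gammaFive_mul_wilsonDirac)
open Matrix
open scoped ComplexOrder

/-! ### (4) The abstract core on the Wilson cell -/

set_option maxHeartbeats 1600000 in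
/-- **The lintegral form of the local Haar–Wegner bound** on one torus, for one site, exterior, mass and
`ε`, from the rigidity data (the abstract core N₂ instantiated on the Wilson cell). -/
theorem coareaWegnerFrom_lintegral_le_const (L₀ : ℕ)
    (hzero : ∀ (N r : ℕ) (A : Matrix (Fin N) (Fin N) ℂ) (B : Matrix (Fin N) (Fin r) ℂ) (C : Matrix (Fin r) (Fin N) ℂ)
      (δ₀ δ₁ δ₂ : Matrix (Fin r) (Fin r) ℂ),
      (∀ t : ℝ, (A + B * (δ₀ + ((Real.cos t : ℝ) : ℂ) • δ₁ + ((Real.sin t : ℝ) : ℂ) • δ₂) * C).det = 0) ∨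
      ({t : ℝ | t ∈ Set.Ico (0 : ℝ) (2 * Real.pi) ∧
          (A + B * (δ₀ + ((Real.cos t : ℝ) : ℂ) • δ₁ + ((Real.sin t : ℝ) : ℂ) • δ₂) * C).det = 0}.Finite ∧
        {t : ℝ | t ∈ Set.Ico (0 : ℝ) (2 * Real.pi) ∧
          (A + B * (δ₀ + ((Real.cos t : ℝ) : ℂ) • δ₁ + ((Real.sin t : ℝ) : ℂ) • δ₂) * C).det = 0}.ncard ≤ 2 * r))
    (hspec : ∀ (n : Type) [Fintype n] [DecidableEq n] (A : Matrix n n ℂ) (hA : A.IsHermitian) (P : Finset n) (ε : ℝ),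
      0 < ε →
      ∑ p ∈ P, ((A - ((ε : ℂ) * Complex.I) • (1 : Matrix n n ℂ))⁻¹ p p).im =
        ∑ j : n, (∑ p ∈ P, ‖(hA.eigenvectorBasis j) p‖ ^ 2) * (ε / (hA.eigenvalues j ^ 2 + ε ^ 2)))
    {R R' k : ℕ} {m c₀ C_B : ℝ} (hkm : (k : ℝ) < m) (hc₀ : 0 < c₀) (hCB : 0 < C_B)
    (bad : ((Fin 4 → ℤ) × Fin 4 → SU3) → ℝ) (hbad_cont : Continuous bad) (hbad0 : ∀ w, 0 ≤ bad w)
    (hsmall : ∀ (L : ℕ) [NeZero L], L₀ ≤ L → ∀ (x : TorusSite 4 L) (U : GaugeConfig 4 L SU3) (e₀ : Edge 4 L) (δ : ℝ),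
      0 < δ → δ ≤ 1 →
      (Measure.pi fun _ : Edge 4 L => haarProbability SU3)
          {V : GaugeConfig 4 L SU3 | ∃ g : SU3,
            bad (fun l => (fun e : Edge 4 L => if (∃ y ∈ box 4 R, e.1 = x + Torus.proj L y) then
                Function.update V e₀ g e else U e) (x + Torus.proj L l.1, l.2)) < δ} ≤
        ENNReal.ofReal (C_B * δ ^ m))
    (hrig2 : ∀ (L : ℕ) [NeZero L], L₀ ≤ L → ∀ (x : TorusSite 4 L) (m₀ : ℝ), -1 ≤ m₀ → m₀ ≤ 0 →
      ∀ (U V : GaugeConfig 4 L SU3) (ψ : QuarkIdx L → ℂ) (lam : ℝ), |lam| ≤ 1 →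
      (spinorLift gammaFive * wilsonDirac (fundamentalRep (Fin 3))
          (fun e => if (∃ y ∈ box 4 R, e.1 = x + Torus.proj L y) then V e else U e) m₀ 1).mulVec ψ =
        (lam : ℂ) • ψ →
      c₀ * bad (fun l => (fun e : Edge 4 L => if (∃ y ∈ box 4 R, e.1 = x + Torus.proj L y) then V e else U e)
              (x + Torus.proj L l.1, l.2)) ^ k *
          boxMass ψ ((box 4 R').image fun y => x + Torus.proj L y) ≤
        ∑ y ∈ box 4 R, ∑ μ : Fin 4, ∑ i : Fin 8,
          |2 * (∑ a : Fin 3, ∑ b : Fin 3, ∑ α : Fin 4, ∑ β : Fin 4,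
              star (ψ (x + Torus.proj L y, a, α)) *
                (gammaFive * ((-(1 / 2 : ℂ)) • ((1 : Matrix (Fin 4) (Fin 4) ℂ) - euclideanGamma μ))) α β *
                ((((fun e : Edge 4 L => if (∃ y ∈ box 4 R, e.1 = x + Torus.proj L y) then V e else U e) (x + Torus.proj L y, μ) : SU3) : Matrix (Fin 3) (Fin 3) ℂ) *
                    (![!![0, 1, 0; -1, 0, 0; 0, 0, 0], !![0, 0, 1; 0, 0, 0; -1, 0, 0],
                   !![0, 0, 0; 0, 0, 1; 0, -1, 0], !![0, Complex.I, 0; Complex.I, 0, 0; 0, 0, 0],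
                   !![0, 0, Complex.I; 0, 0, 0; Complex.I, 0, 0],
                   !![0, 0, 0; 0, 0, Complex.I; 0, Complex.I, 0],
                   !![Complex.I, 0, 0; 0, -Complex.I, 0; 0, 0, 0],
                   !![0, 0, 0; 0, Complex.I, 0; 0, 0, -Complex.I]] i : Matrix (Fin 3) (Fin 3) ℂ)) a b *
                ψ (Literature.MathematicalPhysics.QuantumFieldTheory.Site.shift (x + Torus.proj L y) μ,
                  b, β)).re|)
    {L : ℕ} [NeZero L] (hL : L₀ ≤ L) (x : TorusSite 4 L) {m₀ ε : ℝ} (hm₀ : -1 ≤ m₀) (hm₀' : m₀ ≤ 0)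
    (hε : 0 < ε) (hε1 : ε ≤ 1) (U : GaugeConfig 4 L SU3) :
    ∫⁻ V, ENNReal.ofReal (∑ a : Fin 3, ∑ α : Fin 4,
        (((spinorLift gammaFive * wilsonDirac (fundamentalRep (Fin 3))
            (fun e => if (∃ y ∈ box 4 R, e.1 = x + Torus.proj L y) then V e else U e) m₀ 1 -
          ((ε : ℂ) * Complex.I) • (1 : Matrix (QuarkIdx L) (QuarkIdx L) ℂ))⁻¹ :
            Matrix (QuarkIdx L) (QuarkIdx L) ℂ) (x, a, α) (x, a, α)).im)
        ∂(Measure.pi fun _ : Edge 4 L => haarProbability SU3) ≤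
      ENNReal.ofReal 12 + ENNReal.ofReal c₀⁻¹ * (Fintype.card ((↥(box 4 R) × Fin 4) × Fin 8) *
        (ENNReal.ofReal (2 * Real.pi)⁻¹ * ENNReal.ofReal (4656 * Real.pi) *
          ENNReal.ofReal (1 + C_B * (k / (m - k))))) := by
  -- the eight basis circles
  choose circ hcirc using fun i : Fin 8 => coareaWegner_su3Circles i
  -- continuity of the glue and of the Hermitian Wilson operator
  have hglue : Continuous fun V : GaugeConfig 4 L SU3 =>
      ((fun e : Edge 4 L => if (∃ y ∈ box 4 R, e.1 = x + Torus.proj L y) then V e else U e) :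
        GaugeConfig 4 L SU3) := by
    have h := (cellAverage_continuous_glue (L := L)
      (fun e : Edge 4 L => ∃ y ∈ box 4 R, e.1 = x + Torus.proj L y)).comp (Continuous.prodMk_right U)
    exact h
  have hHW : Continuous fun W : GaugeConfig 4 L SU3 =>
      spinorLift gammaFive * wilsonDirac (fundamentalRep (Fin 3)) W m₀ 1 :=
    continuous_const.mul (continuous_wilsonDirac (fundamentalRep (Fin 3)) (continuous_fundamentalRep (Fin 3)) m₀ 1)
  have hHof : Continuous fun V : GaugeConfig 4 L SU3 => spinorLift gammaFive * wilsonDirac (fundamentalRep (Fin 3))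
      (fun e : Edge 4 L => if (∃ y ∈ box 4 R, e.1 = x + Torus.proj L y) then V e else U e) m₀ 1 := by
    have h := hHW.comp hglue
    exact h
  have herm : ∀ W : GaugeConfig 4 L SU3,
      (spinorLift gammaFive * wilsonDirac (fundamentalRep (Fin 3)) W m₀ 1).IsHermitian := fun W =>
    isHermitian_gammaFive_mul_wilsonDirac (fundamentalRep (Fin 3)) fundamentalRep_mem_unitaryGroup W m₀ 1
  -- cell links
  have hcell : ∀ d : (↥(box 4 R) × Fin 4) × Fin 8,
      ∃ y ∈ box 4 R, ((x + Torus.proj L d.1.1, d.1.2) : Edge 4 L).1 = x + Torus.proj L y :=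
    fun d => ⟨d.1.1, d.1.1.2, rfl⟩
  refine coareaWegner_core_lintegral_le (G := SU3) (ι := Edge 4 L) (n := QuarkIdx L)
    (fun V : GaugeConfig 4 L SU3 => spinorLift gammaFive * wilsonDirac (fundamentalRep (Fin 3))
      (fun e : Edge 4 L => if (∃ y ∈ box 4 R, e.1 = x + Torus.proj L y) then V e else U e) m₀ 1)
    hHof
    (fun V : GaugeConfig 4 L SU3 =>
      herm (fun e : Edge 4 L => if (∃ y ∈ box 4 R, e.1 = x + Torus.proj L y) then V e else U e))
    (fun V : GaugeConfig 4 L SU3 =>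
      ∑ a : Fin 3, ∑ α : Fin 4,
        (((spinorLift gammaFive * wilsonDirac (fundamentalRep (Fin 3))
            (fun e => if (∃ y ∈ box 4 R, e.1 = x + Torus.proj L y) then V e else U e) m₀ 1 -
          ((ε : ℂ) * Complex.I) • (1 : Matrix (QuarkIdx L) (QuarkIdx L) ℂ))⁻¹ :
            Matrix (QuarkIdx L) (QuarkIdx L) ℂ) (x, a, α) (x, a, α)).im)
    (fun V : GaugeConfig 4 L SU3 => bad (fun l => (fun e : Edge 4 L =>
      if (∃ y ∈ box 4 R, e.1 = x + Torus.proj L y) then V e else U e) (x + Torus.proj L l.1, l.2)))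
    ?_ (fun V => hbad0 _) (fun E => ε / (E ^ 2 + ε ^ 2)) ?_ (fun E => by positivity)
    (A₀ := 12) (by norm_num) hc₀ hCB hkm ((x, 0) : Edge 4 L) ?_
    (Dir := (↥(box 4 R) × Fin 4) × Fin 8)
    (fun d => ((x + Torus.proj L d.1.1, d.1.2) : Edge 4 L)) (fun d => circ d.2)
    (fun d => (hcirc d.2).2.1) (fun d => (hcirc d.2).2.2.1) (fun d => (hcirc d.2).2.2.2.2.1)
    (fun d V ψ => 2 * (∑ a : Fin 3, ∑ b : Fin 3, ∑ α : Fin 4, ∑ β : Fin 4,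
              star (ψ (x + Torus.proj L d.1.1, a, α)) *
                (gammaFive * ((-(1 / 2 : ℂ)) • ((1 : Matrix (Fin 4) (Fin 4) ℂ) - euclideanGamma d.1.2))) α β *
                ((((fun e : Edge 4 L => if (∃ y ∈ box 4 R, e.1 = x + Torus.proj L y) then V e else U e)
                      (x + Torus.proj L d.1.1, d.1.2) : SU3) : Matrix (Fin 3) (Fin 3) ℂ) *
                    (![!![0, 1, 0; -1, 0, 0; 0, 0, 0], !![0, 0, 1; 0, 0, 0; -1, 0, 0],
                   !![0, 0, 0; 0, 0, 1; 0, -1, 0], !![0, Complex.I, 0; Complex.I, 0, 0; 0, 0, 0],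
                   !![0, 0, Complex.I; 0, 0, 0; Complex.I, 0, 0],
                   !![0, 0, 0; 0, 0, Complex.I; 0, Complex.I, 0],
                   !![Complex.I, 0, 0; 0, -Complex.I, 0; 0, 0, 0],
                   !![0, 0, 0; 0, Complex.I, 0; 0, 0, -Complex.I]] d.2 : Matrix (Fin 3) (Fin 3) ℂ)) a b *
                ψ (Literature.MathematicalPhysics.QuantumFieldTheory.Site.shift (x + Torus.proj L d.1.1) d.1.2,
                  b, β)).re)
    ?_ ?_ ?_ (B := ENNReal.ofReal (4656 * Real.pi)) ?_ ?_
  · -- continuity of the badness of the glued cell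
    refine hbad_cont.comp (continuous_pi fun l => ?_)
    exact (continuous_apply (x + Torus.proj L l.1, l.2)).comp hglue
  · -- continuity of the window
    exact continuous_const.div (by fun_prop) fun E => by positivity
  · -- small saturated tubes
    intro e' δ hδ hδ1
    exact hsmall L hL x U e' δ hδ hδ1
  · -- the current is the `s`-derivative of the quadratic form (transport of bridge A)
    intro d V ψ
    beta_reduce
    have T := coareaWegner_glued_hellmannFeynman R x U V m₀ (d.1.1 : Fin 4 → ℤ) d.1.1.2 d.1.2
      (![!![0, 1, 0; -1, 0, 0; 0, 0, 0], !![0, 0, 1; 0, 0, 0; -1, 0, 0],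
                   !![0, 0, 0; 0, 0, 1; 0, -1, 0], !![0, Complex.I, 0; Complex.I, 0, 0; 0, 0, 0],
                   !![0, 0, Complex.I; 0, 0, 0; Complex.I, 0, 0],
                   !![0, 0, 0; 0, 0, Complex.I; 0, Complex.I, 0],
                   !![Complex.I, 0, 0; 0, -Complex.I, 0; 0, 0, 0],
                   !![0, 0, 0; 0, Complex.I, 0; 0, 0, -Complex.I]] d.2 : Matrix (Fin 3) (Fin 3) ℂ)
      (circ d.2) (hcirc d.2).2.2.2.2.2 ψ
    exact T
  · -- Lipschitz sorted eigenvalues along circles (transport of bridge H)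
    intro d V
    obtain ⟨δ₀, δ₁, δ₂, hcshape⟩ := (hcirc d.2).1
    have T := coareaWegner_glued_eigenvalues₀_lipschitz R x U V m₀ (x + Torus.proj L d.1.1, d.1.2) (hcell d)
      (circ d.2) δ₀ δ₁ δ₂ hcshape herm
    exact T
  · -- entrywise differentiability of the circle family (transport of bridge H′)
    intro d V
    obtain ⟨δ₀, δ₁, δ₂, hcshape⟩ := (hcirc d.2).1
    have T := coareaWegner_glued_hasDerivAt_entry R x U V m₀ (x + Torus.proj L d.1.1, d.1.2) (hcell d)
      (circ d.2) δ₀ δ₁ δ₂ hcshape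
    exact T
  · -- the area bound along each circle (transport of bridge M)
    intro d V
    obtain ⟨δ₀, δ₁, δ₂, hcshape⟩ := (hcirc d.2).1
    have T := coareaWegner_glued_areaBound hzero R x U V m₀ (x + Torus.proj L d.1.1, d.1.2) (hcell d)
      (circ d.2) δ₀ δ₁ δ₂ hcshape (hcirc d.2).2.2.2.1 herm hε
    exact T
  · -- the pointwise tail/weight/rigidity bound (bridge G), directions reindexed
    intro V hbV
    beta_reduce at hbV ⊢
    have hG := coareaWegner_localTrace_pointwise hspec x
      (fun e : Edge 4 L => if (∃ y ∈ box 4 R, e.1 = x + Torus.proj L y) then V e else U e) m₀ hε hε1 hc₀ hbV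
      (herm _) (fun ψ lam hlam hψ => hrig2 L hL x m₀ hm₀ hm₀' U V ψ lam hlam hψ)
    rw [coareaWegner_sum_box_dir (box 4 R)] at hG
    exact hG

/-! ### (5) The stub -/

set_option maxHeartbeats 400000 in
/-- **Stub `coareaWegner`, RANGED (`L ≥ L₀`, explicit radius `R` and rigidity data; gen 4b).**  See the landed
`stub_coareaWegner` for the un-ranged existential form.   (the abstract analysis: one-link circles, Hellmann–Feynman, 1-D area formula, tube sum).**
IF (a) one-link circles meet level sets at most `2r` times (`stub_circleZeroCount`, verbatim), (b) the site-local
resolvent trace is the mass-weighted spectral sum (`stub_resolventLocalSpectralSum`, verbatim), and (c) near-zero modes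
obey current/mass rigidity with a small-saturated-tube exceptional set (`stub_currentRigidity`, verbatim), THEN the local
Haar–Wegner lemma with frozen genuine exterior holds (hypothesis of the landed `wegnerEstimate_of_localHaarWegner`, p91808,
verbatim).  Paper proof (Lines/Sketch.md §gen 2, 1-D route): `E_V t_x = Σ_j E_V w_j φ_ε(λ_j)` by (b); `w_j ≤ m_j`; modes
with `|λ_j| > 1` give `≤ 12·(2R'+1)⁴`; for the rest (c) bounds `m_j ≤ c₀⁻¹ bad^{-k} Σ_d |J_d(ψ_j)|` (ℓ¹ over the
`32·#cell` directions `d = (e, X_i)`, valid for ANY orthonormal eigenbasis); for each `d`, right-invariance of product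
Haar under `V ↦ V[e ↦ V(e) c_i(t)]` (the closed SU(3) circle with velocity `X_i`, bridge p136162) and Tonelli reduce to the
one-parameter family `t ↦ H(V[e ↦ V(e)c_i(t)])`, along which `J_d(ψ_j) = λ_j′` (Hellmann–Feynman, bridge p135597; at
degenerate `t` use `Σ_{j∈cluster}|⟨ψ_j,H′ψ_j⟩| ≤ ‖P H′ P‖₁`), `bad^{-k} ≤ (min_g bad(V[e↦g]))^{-k}` is constant along the
circle with expectation `≤ 1 + C_B k/(m−k)` (tube sum, bridge p136589, from (c)(i) and `k < m`), and
`∫₀^{2π} Σ_j |λ_j′| φ_ε(λ_j) dt = ∫ φ_ε(E) N(E) dE ≤ π · 2r · 24` with `r = 24` by (a) in the shape of bridge p136155 and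
the multiplicity bound of bridge p136473 (1-D area formula on the monotone pieces of the ordered eigenvalues, which are
Lipschitz by Weyl and real-analytic with finitely many critical points off the finitely many zeros of the discriminant;
a permanently degenerate family is handled by `H + ηD`, `η → 0`).  Constants depend on `R` only.  No coarea formula and no
Crofton formula on `SU(3)^{8n}` are needed on this route; Rellich–Kato (Kato, Perturbation Theory II §6 Thm 6.1) would
shortcut the branch bookkeeping.  Sources: Erdős–Hasler, AHP 13 (2012) 1719, §3 (currents as level velocities); Kato II §6;
Federer 3.2.3 (1-D area formula). -/
theorem stub_coareaWegnerFrom (L₀ R R' k : ℕ) (m c₀ C_B : ℝ) (hkm : (k : ℝ) < m)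
    (hc₀ : 0 < c₀) (hCB : 0 < C_B) (bad : ((Fin 4 → ℤ) × Fin 4 → SU3) → ℝ) (hbad_cont : Continuous bad)
    (hbad0 : ∀ w, 0 ≤ bad w)
    (hzero : ∀ (N r : ℕ) (A : Matrix (Fin N) (Fin N) ℂ) (B : Matrix (Fin N) (Fin r) ℂ) (C : Matrix (Fin r) (Fin N) ℂ)
      (δ₀ δ₁ δ₂ : Matrix (Fin r) (Fin r) ℂ),
      (∀ t : ℝ, (A + B * (δ₀ + ((Real.cos t : ℝ) : ℂ) • δ₁ + ((Real.sin t : ℝ) : ℂ) • δ₂) * C).det = 0) ∨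
      ({t : ℝ | t ∈ Set.Ico (0 : ℝ) (2 * Real.pi) ∧
          (A + B * (δ₀ + ((Real.cos t : ℝ) : ℂ) • δ₁ + ((Real.sin t : ℝ) : ℂ) • δ₂) * C).det = 0}.Finite ∧
        {t : ℝ | t ∈ Set.Ico (0 : ℝ) (2 * Real.pi) ∧
          (A + B * (δ₀ + ((Real.cos t : ℝ) : ℂ) • δ₁ + ((Real.sin t : ℝ) : ℂ) • δ₂) * C).det = 0}.ncard ≤ 2 * r))
    (hspec : ∀ (n : Type) [Fintype n] [DecidableEq n] (A : Matrix n n ℂ) (hA : A.IsHermitian) (P : Finset n) (ε : ℝ),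
      0 < ε →
      ∑ p ∈ P, ((A - ((ε : ℂ) * Complex.I) • (1 : Matrix n n ℂ))⁻¹ p p).im =
        ∑ j : n, (∑ p ∈ P, ‖(hA.eigenvectorBasis j) p‖ ^ 2) * (ε / (hA.eigenvalues j ^ 2 + ε ^ 2)))
    (hsmall : ∀ (L : ℕ) [NeZero L], L₀ ≤ L → ∀ (x : TorusSite 4 L) (U : GaugeConfig 4 L SU3) (e₀ : Edge 4 L) (δ : ℝ),
          0 < δ → δ ≤ 1 →
          (Measure.pi fun _ : Edge 4 L => haarProbability SU3)
              {V : GaugeConfig 4 L SU3 | ∃ g : SU3,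
                bad (fun l => (fun e : Edge 4 L => if (∃ y ∈ box 4 R, e.1 = x + Torus.proj L y) then
                    Function.update V e₀ g e else U e) (x + Torus.proj L l.1, l.2)) < δ} ≤
            ENNReal.ofReal (C_B * δ ^ m))
    (hrig2 : ∀ (L : ℕ) [NeZero L], L₀ ≤ L → ∀ (x : TorusSite 4 L) (m₀ : ℝ), -1 ≤ m₀ → m₀ ≤ 0 →
          ∀ (U V : GaugeConfig 4 L SU3) (ψ : QuarkIdx L → ℂ) (lam : ℝ), |lam| ≤ 1 →
          (spinorLift gammaFive * wilsonDirac (fundamentalRep (Fin 3))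
              (fun e => if (∃ y ∈ box 4 R, e.1 = x + Torus.proj L y) then V e else U e) m₀ 1).mulVec ψ =
            (lam : ℂ) • ψ →
          c₀ * bad (fun l => (fun e : Edge 4 L => if (∃ y ∈ box 4 R, e.1 = x + Torus.proj L y) then V e else U e)
                  (x + Torus.proj L l.1, l.2)) ^ k *
              boxMass ψ ((box 4 R').image fun y => x + Torus.proj L y) ≤
            ∑ y ∈ box 4 R, ∑ μ : Fin 4, ∑ i : Fin 8,
              |2 * (∑ a : Fin 3, ∑ b : Fin 3, ∑ α : Fin 4, ∑ β : Fin 4,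
                  star (ψ (x + Torus.proj L y, a, α)) *
                    (gammaFive * ((-(1 / 2 : ℂ)) • ((1 : Matrix (Fin 4) (Fin 4) ℂ) - euclideanGamma μ))) α β *
                    ((((fun e : Edge 4 L => if (∃ y ∈ box 4 R, e.1 = x + Torus.proj L y) then V e else U e)
                          (x + Torus.proj L y, μ) : SU3) : Matrix (Fin 3) (Fin 3) ℂ) *
                        (![!![0, 1, 0; -1, 0, 0; 0, 0, 0], !![0, 0, 1; 0, 0, 0; -1, 0, 0],
                           !![0, 0, 0; 0, 0, 1; 0, -1, 0], !![0, Complex.I, 0; Complex.I, 0, 0; 0, 0, 0],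
                           !![0, 0, Complex.I; 0, 0, 0; Complex.I, 0, 0],
                           !![0, 0, 0; 0, 0, Complex.I; 0, Complex.I, 0],
                           !![Complex.I, 0, 0; 0, -Complex.I, 0; 0, 0, 0],
                           !![0, 0, 0; 0, Complex.I, 0; 0, 0, -Complex.I]] i : Matrix (Fin 3) (Fin 3) ℂ)) a b *
                    ψ (Literature.MathematicalPhysics.QuantumFieldTheory.Site.shift (x + Torus.proj L y) μ,
                      b, β)).re|) :
    ∃ C : ℝ, 0 < C ∧ ∀ (L : ℕ) [NeZero L], L₀ ≤ L →
      ∀ (x : TorusSite 4 L) (m₀ ε : ℝ), -1 ≤ m₀ → m₀ ≤ 0 → 0 < ε → ε ≤ 1 →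
      ∀ U : GaugeConfig 4 L SU3,
        ∫ V, (∑ a : Fin 3, ∑ α : Fin 4,
          (((spinorLift gammaFive * wilsonDirac (fundamentalRep (Fin 3))
              (fun e => if (∃ y ∈ box 4 R, e.1 = x + Torus.proj L y) then V e else U e) m₀ 1 -
            ((ε : ℂ) * Complex.I) • (1 : Matrix (QuarkIdx L) (QuarkIdx L) ℂ))⁻¹ :
              Matrix (QuarkIdx L) (QuarkIdx L) ℂ) (x, a, α) (x, a, α)).im)
          ∂(Measure.pi fun _ : Edge 4 L => haarProbability SU3) ≤ C := by
  have hmk : 0 < m - k := sub_pos.2 hkm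
  have hWt : 0 ≤ 1 + C_B * (k / (m - k)) := by positivity
  refine ⟨12 + c₀⁻¹ * (Fintype.card ((↥(box 4 R) × Fin 4) × Fin 8) * (2328 * (1 + C_B * (k / (m - k))))),
    by positivity, ?_⟩
  intro L _ hL x m₀ ε hm₀ hm₀' hε hε1 U
  have hlin := coareaWegnerFrom_lintegral_le_const L₀ hzero hspec hkm hc₀ hCB bad hbad_cont hbad0 hsmall hrig2 hL x hm₀
    hm₀' hε hε1 U
  -- evaluate the constant
  have hconst : ENNReal.ofReal 12 + ENNReal.ofReal c₀⁻¹ * (Fintype.card ((↥(box 4 R) × Fin 4) × Fin 8) *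
      (ENNReal.ofReal (2 * Real.pi)⁻¹ * ENNReal.ofReal (4656 * Real.pi) * ENNReal.ofReal (1 + C_B * (k / (m - k))))) =
      ENNReal.ofReal (12 + c₀⁻¹ * (Fintype.card ((↥(box 4 R) × Fin 4) × Fin 8) *
        (2328 * (1 + C_B * (k / (m - k)))))) := by
    have h1 : ENNReal.ofReal (2 * Real.pi)⁻¹ * ENNReal.ofReal (4656 * Real.pi) = ENNReal.ofReal 2328 := by
      rw [← ENNReal.ofReal_mul (inv_nonneg.2 Real.two_pi_pos.le)]
      congr 1
      field_simp
      ring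
    rw [h1, ← ENNReal.ofReal_mul (by norm_num), ← ENNReal.ofReal_natCast, ← ENNReal.ofReal_mul (Nat.cast_nonneg _),
      ← ENNReal.ofReal_mul (inv_nonneg.2 hc₀.le), ← ENNReal.ofReal_add (by norm_num) (by positivity)]
  rw [hconst] at hlin
  -- integrability of the local trace and conversion to the Bochner integral
  have htxr := stub_localTraceRegular L x m₀ ε hε
  have hglue : Continuous fun V : GaugeConfig 4 L SU3 =>
      ((fun e : Edge 4 L => if (∃ y ∈ box 4 R, e.1 = x + Torus.proj L y) then V e else U e) :
        GaugeConfig 4 L SU3) := by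
    have h := (cellAverage_continuous_glue (L := L)
      (fun e : Edge 4 L => ∃ y ∈ box 4 R, e.1 = x + Torus.proj L y)).comp (Continuous.prodMk_right U)
    exact h
  have hcont : Continuous fun V : GaugeConfig 4 L SU3 => ∑ a : Fin 3, ∑ α : Fin 4,
        (((spinorLift gammaFive * wilsonDirac (fundamentalRep (Fin 3))
            (fun e => if (∃ y ∈ box 4 R, e.1 = x + Torus.proj L y) then V e else U e) m₀ 1 -
          ((ε : ℂ) * Complex.I) • (1 : Matrix (QuarkIdx L) (QuarkIdx L) ℂ))⁻¹ :
            Matrix (QuarkIdx L) (QuarkIdx L) ℂ) (x, a, α) (x, a, α)).im := by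
    have h := htxr.1.comp hglue
    exact h
  have hnn : 0 ≤ᵐ[Measure.pi fun _ : Edge 4 L => haarProbability SU3] fun V : GaugeConfig 4 L SU3 => ∑ a : Fin 3, ∑ α : Fin 4,
        (((spinorLift gammaFive * wilsonDirac (fundamentalRep (Fin 3))
            (fun e => if (∃ y ∈ box 4 R, e.1 = x + Torus.proj L y) then V e else U e) m₀ 1 -
          ((ε : ℂ) * Complex.I) • (1 : Matrix (QuarkIdx L) (QuarkIdx L) ℂ))⁻¹ :
            Matrix (QuarkIdx L) (QuarkIdx L) ℂ) (x, a, α) (x, a, α)).im :=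
    Filter.Eventually.of_forall fun V => (htxr.2 _).1
  rw [integral_eq_lintegral_of_nonneg_ae hnn hcont.aestronglyMeasurable]
  exact ENNReal.toReal_le_of_le_ofReal (by positivity) hlin

end Summit.QuantumFields.QCD.Cruxes.WegnerEstimate.ResolventCell

end
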